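import Summits.BirchSwinnertonDyer.Rank1Residual.X5.TwoAdicTargetsSplitAuto
import Summits.BirchSwinnertonDyer.Rank1Residual.X5.TwoAdicTargetsCalibMult
import Summits.BirchSwinnertonDyer.Rank1Residual.X2.AnalyticInvariants
import Literature.NumberTheory.EllipticCurves.PAdicHeightsLogProofs
import Literature.NumberTheory.EllipticCurves.PAdicHeightsLInvariantHoldsProofs
import Literature.NumberTheory.EllipticCurves.PAdicLFunctionIntegralityAtTwoProofs
import HarnessLib

/-!
# Class O1 (X5, `p = 2`, non-CM): the λ/μ-PINCH at a SPLIT multiplicative `2` — from K11b-Rat,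
# `μ = 0`, `λ(X) = n` and two finite certificates to `char_Λ X = (L₁)`, and from that equality (with
# the Greenberg–Stevens formula at `2`) to `BSD(E,2)` in BOTH halves and to the rank-`0` `2`-converse

HONEST FRAMING (cell `bsd-2adic`, run/shared/lean/pub/bsd-2adic/, FULL-BSD rank ≤ 1 programme
tranche 1b, D-0036; seat `bsd-2adic-mult`, GEN 2): research routes; no claim beyond the stated
classes; nothing here is booked; no mark of RESIDUAL-MAP §I moves. THEOREMS ONLY (0 defs, 0 named
facts, 0 `@[conjecture]`). The split twin of `X5/TwoAdicTargetsMultPinch.lean`; consumed by the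
twist-anchor door (34-TW-mult) of `X5/TwoAdicTargetsMultTwist.lean`. Memo: `HOME/mult/PROOF-TWIST.md`.

* `charIdeal_eq_span_X_mul_of_lambda_mu_pinch_split` (PROVED): `W` split multiplicative at `2`; a
  cyclotomic dual datum with `X` torsion, `μ(X) = 0`, `λ(X) = n`; the K11b-Rat datum `ι(T·g) = 2ᵐ·L`,
  `g ∈ char X` (`X5/TwoAdicTargetsSplitEnd.lean`; the seat's PROOF-MULT Thm. B); `ι L₀ = ϖ·L`; the
  certificates `λ(ϖ·L) = n + 1` (`X2.AnalyticLambdaEq W 2 (n+1)`, trivial zero INCLUDED) and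
  `μ(ϖ·L) = 0` (`X2.AnalyticMuLE W 2 0`) ⇒ `char_Λ X = (L₁)` with `ι(T·L₁) = ϖ·L` (the split main
  conjecture up to the conceded trivial-zero factor `T`). Pure `Λ`-algebra on the deflated `μ = 0`
  upgrade `exists_mem_charIdeal_X_mul_of_mu_eq_zero`.
* `missingPPartAt_two_split_of_charIdeal_eq_span` (PROVED): that equality + Greenberg's split display
  A236 (`hEC`) + the tree's named fact `greenberg_stevens W 2` (`[T¹]L·log₂ γ = 𝓛₂(E)·[0]⁺_f`; memo
  PROOF-GS2, referee PASS RC-4) ⇒ `MissingPPartAt W 2` (`ord₂ #Ш_an = ord₂ #Ш`): with `f_E := L₁`,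
  `L₁(0) = ϖ·[T¹]L`, `L₁(0)·#E(ℚ)(2)² = u·(𝓛₂/4)·2^{ord₂∏c}·#Sel`, `ord₂ log₂ γ = 2` — the `𝓛`-invariant
  and the two `4`s cancel. BOTH halves; no `hlow`, no `hκ₁`.
* `entireLFunction_one_ne_zero_of_finite_selmer_of_charIdeal_eq_span_split` (PROVED): the rank-`0`
  `2`-CONVERSE from the same equality: `Sel_{2^∞}(E/ℚ)` finite ⇒ `L₁(0) ≠ 0` ⇒ `[T¹]L ≠ 0` ⇒ (GS)
  `[0]⁺_f ≠ 0` ⇒ `L(E,1) ≠ 0`.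

References: [GreenbergLNM1716] §4 pp. 112–113; [GreenbergVatsal2000] p. 4; [MazurTateTeitelbaum1986Invent]
§I.14–15, §II; [Kobayashi2006DocMath] Cor. 4.2 (shape, odd p); [Iwasawa1972PadicL] §4.4;
[BarreSirieixDiazGramainPhilibert1996Manin] Thm. 1; [Miller2011LMS] Def. 1.1.
-/

set_option autoImplicit false

noncomputable section

open scoped Classical MatrixGroups ModularForm

open CongruenceSubgroup WeierstrassCurve Literature.NumberTheory.EllipticCurves
  Literature.NumberTheory.EllipticCurves.ModularForms
  Literature.NumberTheory.EllipticCurves.Wuthrich2014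
  Literature.NumberTheory.EllipticCurves.Rank1Residual
  Literature.NumberTheory.EllipticCurves.Rank1Residual.Typed
  Literature.NumberTheory.EllipticCurves.Greenberg1999
  Literature.NumberTheory.Transcendental
  Summit.BirchSwinnertonDyer.Rank1Residual.X1.MuLambda
  Summit.BirchSwinnertonDyer.Rank1Residual.X1.MuPart
  Summit.BirchSwinnertonDyer.Rank1Residual.X1.ParitySqueeze

namespace Summit.BirchSwinnertonDyer.Rank1Residual.X5.O1

variable (W : WeierstrassCurve ℚ) [W.IsElliptic] [W.IsGloballyMinimal]

/-! ## §1 The pinch at a SPLIT `2` -/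

/-- **The `λ/μ`-pinch at a split multiplicative `2` (PROVED).** See the module docstring, first bullet:
from `μ(X) = 0`, `λ(X) = n`, the K11b-Rat datum, `ι L₀ = ϖ·L`, `λ(L₀) = n + 1` and `μ(L₀) = 0` to
`char_Λ X = (L₁)` with `ι(T·L₁) = ϖ·L`: deflate (`L₁ ∈ (f_X)`, `L₀ = T·L₁`), `λ(L₁) = n`, `μ(L₁) = 0`,
then `X1.MuLambda.span_eq_span_iff_mu_lam`. No rank input. [cite: GreenbergVatsal2000, p. 4 (after Thm. (1.2))]
[cite: MazurTateTeitelbaum1986Invent, §I.15 (L(0) = 0 at a split prime)] -/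
theorem charIdeal_eq_span_X_mul_of_lambda_mu_pinch_split
    (hsp : W.HasSplitMultiplicativeReductionAtPrime 2) {n : ℕ}
    (hlan : X2.AnalyticLambdaEq W 2 (n + 1)) (hμan : X2.AnalyticMuLE W 2 0)
    {κ : ZpExtension ℚ 2} {γ : Field.absoluteGaloisGroup ℚ} (hγ : κ.IsTopGenerator γ)
    {N : ℕ} [NeZero N] {f : CuspForm (Gamma0 N) 2} (hf : IsNewformOf W f) {L : PowerSeries ℚ_[2]}
    (hLf : IsSplitMultPAdicLFunctionOf f 2 L) (D : W.SelmerDualData κ γ) (hX : D.IsTorsion)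
    (hμ : D.mu = 0) (hlam : D.lambda = n)
    (hdiv : ∃ (m : ℕ) (g : IwasawaAlgebra 2), g ∈ D.charIdeal ∧
      iwasawaToPowerSeries 2 (PowerSeries.X * g) = PowerSeries.C ((2 : ℚ_[2]) ^ m) * L)
    {ϖ : ℚ} (hϖ : (ϖ : ℝ) * W.realPeriodRat = plusPeriod f) {L₀ : IwasawaAlgebra 2}
    (hL₀ : iwasawaToPowerSeries 2 L₀ = PowerSeries.C (ϖ : ℚ_[2]) * L) :
    ∃ L₁ : IwasawaAlgebra 2, D.charIdeal = Ideal.span {L₁} ∧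
      iwasawaToPowerSeries 2 (PowerSeries.X * L₁) = PowerSeries.C (ϖ : ℚ_[2]) * L := by
  haveI : Module.Finite (IwasawaAlgebra 2) D.X := D.module_finite_holds hγ
  obtain ⟨L₁, hmem, hιL₁⟩ := exists_mem_charIdeal_X_mul_of_mu_eq_zero W hγ D hX hμ
    hLf.constantCoeff_eq_zero hdiv hL₀
  have hL₀eq : L₀ = PowerSeries.X * L₁ :=
    iwasawaToPowerSeries_injective 2 (by rw [hL₀, hιL₁])
  obtain ⟨k, hk⟩ := hμan f hf ϖ hϖ L (fun _ => hLf) (fun hns => absurd hsp hns)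
  rw [← hL₀] at hk
  have hμL₀ : mu L₀ = 0 := Nat.le_zero.mp (mu_le_of_lt_norm_coeff hk)
  have hL₀0 : L₀ ≠ 0 := by
    rintro rfl
    rw [map_zero, map_zero, norm_zero] at hk
    exact not_le.mpr hk (by positivity)
  have hL₁0 : L₁ ≠ 0 := by
    rintro rfl
    exact hL₀0 (by rw [hL₀eq, mul_zero])
  have hX0 : (PowerSeries.X : IwasawaAlgebra 2) ≠ 0 := PowerSeries.X_ne_zero
  have hlan' : lam L₀ = n + 1 := hlan f hf ϖ hϖ L (fun _ => hLf) (fun hns => absurd hsp hns) L₀ hL₀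
  have hlamL₁ : lam L₁ = n := by
    rw [hL₀eq, lam_mul hX0 hL₁0, X2.lam_X] at hlan'
    omega
  have hμL₁ : mu L₁ = 0 := by
    rw [hL₀eq, mu_mul hX0 hL₁0, X2.mu_X_eq_zero_and_pfree_X.1] at hμL₀
    omega
  haveI : (Module.charIdeal (IwasawaAlgebra 2) D.X).IsPrincipal := charIdeal_isPrincipal_holds 2 D.X
  obtain ⟨fX, hfX⟩ := Submodule.IsPrincipal.principal (Module.charIdeal (IwasawaAlgebra 2) D.X)
  have hchar : D.charIdeal = Ideal.span {fX} := hfX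
  have hfX0 : fX ≠ 0 := by
    intro h0
    refine Module.charIdeal_ne_bot (IwasawaAlgebra 2) D.X ?_
    change D.charIdeal = ⊥
    rw [hchar, h0]
    exact Ideal.span_singleton_eq_bot.mpr rfl
  have hlamfX : lam fX = D.lambda := lam_generator_eq_lambdaInvariant D.X hX hfX0 hchar
  have hlamEq : lam L₁ = lam fX := by rw [hlamL₁, hlamfX, hlam]
  have hμfX : mu fX = 0 := by
    rw [mu_generator_eq_muInvariant D.X hX hfX0 hchar]; exact hμ
  rw [hchar] at hmem
  obtain ⟨b, hb⟩ := Ideal.mem_span_singleton'.mp hmem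
  have hspan : Ideal.span ({L₁} : Set (IwasawaAlgebra 2)) = Ideal.span {fX} :=
    (span_eq_span_iff_mu_lam hfX0 hL₁0 (show L₁ = fX * b by rw [mul_comm, hb])).mpr
      ⟨hμL₁.trans hμfX.symm, hlamEq⟩
  exact ⟨L₁, by rw [hchar, hspan], hιL₁⟩

/-! ## §2 `ord₂ log₂ γ = 2` (the cyclotomic variable at `2` is `γ = 5`) -/

/-- **`ord₂ log₂ 5 = 2`** (`γ = cyclotomicGenerator 2 = 5 = 1 + 2²`; `‖log₂ y‖ = ‖1 − y‖` on
`‖1 − y‖ < ‖2‖`, `norm_padicLogSeries_eq`). A private copy of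
`valuation_padicLog_cyclotomicGenerator_two` of `X5/TwoAdicTargetsSplitGS.lean` (that module is not
imported here: its olean is not yet available to importers on the farm). [cite: Iwasawa1972PadicL, §4.4] -/
private theorem valuation_padicLog_cyclotomicGenerator_two_eq :
    (padicLog 2 ((cyclotomicGenerator 2 : ℕ) : ℚ_[2])).valuation = 2 := by
  have h5 : ((cyclotomicGenerator 2 : ℕ) : ℚ_[2]) = 5 := by
    rw [cyclotomicGenerator_two]; norm_num
  rw [h5]
  have h14 : (1 : ℚ_[2]) - 5 = -((2 : ℚ_[2]) ^ 2) := by norm_num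
  have hnorm14 : ‖(1 : ℚ_[2]) - 5‖ = (2 : ℝ) ^ (-(2 : ℤ)) := by
    rw [h14, norm_neg]
    have := Padic.norm_p_pow (p := 2) 2
    exact_mod_cast this
  have h2 : ‖(2 : ℚ_[2])‖ = (2 : ℝ)⁻¹ := by exact_mod_cast Padic.norm_p (p := 2)
  have hlt2 : ‖(1 : ℚ_[2]) - 5‖ < ‖(2 : ℚ_[2])‖ := by
    rw [hnorm14, h2]; norm_num
  have hlt1 : ‖(1 : ℚ_[2]) - 5‖ < 1 := by rw [hnorm14]; norm_num
  rw [padicLog_eq_padicLogSeries hlt1]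
  have hn : ‖padicLogSeries 2 (5 : ℚ_[2])‖ = (2 : ℝ) ^ (-(2 : ℤ)) := by
    rw [norm_padicLogSeries_eq hlt2, hnorm14]
  have hne : padicLogSeries 2 (5 : ℚ_[2]) ≠ 0 := by
    intro h0; rw [h0, norm_zero] at hn; exact absurd hn (by positivity)
  exact valuation_eq_of_norm_eq hne (by exact_mod_cast hn)

/-! ## §3 From `char_Λ X = (L₁)`, `ι(T·L₁) = ϖ·L` at a split `2` to `BSD₂(E)` (both halves) -/

/-- **The EXACT `2`-adic valuation of `L(E,1)/Ω_E` from the split main-conjecture equality and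
Greenberg–Stevens at `2` (PROVED).** `W` split multiplicative at `2`, `L(E,1) ≠ 0`; A236 as `hEC`
(`TwoAdicEulerCharRankZeroSplitMult W 0`); GZK; the tree's named fact `greenberg_stevens W 2` (`hGS`); a
cyclotomic dual datum with `X` torsion, `char_Λ X = (L₁)`, `ι(T·L₁) = ϖ·L`, `L` THE split `2`-adic
`L`-function of the newform `f`, `ϖ·Ω_E = Ω⁺_f`. Then `MissingPPartAt W 2`. Proof: with `f_E := L₁`,
A236 reads `L₁(0)·#E(ℚ)(2)² = u·(𝓛₂(E)/4)·2^{ord₂∏c}·#Sel`; `L₁(0) = [T¹](ι(T·L₁)) = ϖ·[T¹]L` and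
`[T¹]L·log₂ γ = 𝓛₂(E)·[0]⁺_f` (GS), `ord₂ log₂ γ = 2`: hence `ord₂(ϖ·[0]⁺_f) + 2·ord₂ #E(ℚ)_tors =
ord₂ ∏c + ord₂ #Ш`, i.e. Miller's `ord₂ #Ш_an = ord₂ #Ш`. [cite: GreenbergLNM1716, §4 pp. 112–113 (split l_v) and §3 p. 94]
[cite: MazurTateTeitelbaum1986Invent, §II (exceptional zero)] [cite: Miller2011LMS, Def. 1.1] -/
theorem missingPPartAt_two_split_of_charIdeal_eq_span
    (hEC : TwoAdicEulerCharRankZeroSplitMult W 0)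
    (hGS : greenberg_stevens (W := W) (p := 2))
    (hGZK : rank_eq_analyticRank_of_analyticRank_le_one)
    (hmult : Mult W 2) (hsp : W.HasSplitMultiplicativeReductionAtPrime 2)
    (hL : W.entireLFunction 1 ≠ 0)
    {κ : ZpExtension ℚ 2} {γ : Field.absoluteGaloisGroup ℚ} {N : ℕ} [NeZero N]
    {f : CuspForm (Gamma0 N) 2} (hκ : κ.IsCyclotomic) (hγ : κ.IsTopGenerator γ)
    (hγ' : IsCyclotomicVariable 2 γ) (hf : IsNewformOf W f) {L : PowerSeries ℚ_[2]}
    (hLf : IsSplitMultPAdicLFunctionOf f 2 L) (D : W.SelmerDualData κ γ) (hX : D.IsTorsion)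
    {ϖ : ℚ} (hϖ : (ϖ : ℝ) * W.realPeriodRat = plusPeriod f) {L₁ : IwasawaAlgebra 2}
    (hιL₁ : iwasawaToPowerSeries 2 (PowerSeries.X * L₁) = PowerSeries.C (ϖ : ℚ_[2]) * L)
    (hchar : D.charIdeal = Ideal.span {L₁}) : MissingPPartAt W 2 := by
  -- the rational number `t = ϖ · [0]⁺_f = L(E,1)/Ω_E`
  have hΩpos : 0 < W.realPeriodRat := W.realPeriodRat_pos_holds
  have hϖ0 : ϖ ≠ 0 := by
    rintro rfl
    have hper : 0 < plusPeriod f := IsNewform0.plusPeriod_pos_holds hf.1 hf.coeffField_eq_bot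
    rw [← hϖ, Rat.cast_zero, zero_mul] at hper
    exact lt_irrefl _ hper
  set s : ℚ := ratPlusSymbol f 0 with hs_def
  set t : ℚ := ϖ * s with ht_def
  have hLval : W.entireLFunction 1 = (((s : ℝ) * plusPeriod f : ℝ) : ℂ) := hf.entireLFunction_one_eq
  have hq : W.entireLFunction 1 / (W.realPeriodRat : ℂ) = ((t : ℚ) : ℂ) := by
    rw [hLval, ← hϖ, div_eq_iff (Complex.ofReal_ne_zero.mpr hΩpos.ne'), ht_def]
    push_cast
    ring
  have hs0 : s ≠ 0 := by
    intro h0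
    apply hL
    rw [hLval, h0]
    simp
  haveI : Module.Finite (IwasawaAlgebra 2) D.X := D.module_finite_holds hγ
  -- the Tate datum, `log₂ q ≠ 0`, `𝓛₂(E) ≠ 0`, and Greenberg–Stevens: `c₁ · log₂ γ = 𝓛 · s`
  obtain ⟨Dq⟩ := (nonempty_tateParameterData_iff_holds (W := W) (p := 2)).mpr hsp
  have hlog : padicLog 2 Dq.q ≠ 0 := Dq.padicLog_q_ne_zero MahlerManinPadic_holds
  have hLI : LInvariant Dq ≠ 0 := LInvariant_ne_zero_holds (W := W) (p := 2) Dq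
  obtain ⟨-, hGS1⟩ := hGS Dq hf hLf
  set c₁ : ℚ_[2] := PowerSeries.coeff 1 L with hc₁_def
  set lg : ℚ_[2] := padicLog 2 ((cyclotomicGenerator 2 : ℕ) : ℚ_[2]) with hlg
  have hvlg : lg.valuation = 2 := valuation_padicLog_cyclotomicGenerator_two_eq
  have hlg0 : lg ≠ 0 := by
    intro h0; rw [h0, Padic.valuation_zero] at hvlg; exact absurd hvlg (by norm_num)
  have hsQ0 : (s : ℚ_[2]) ≠ 0 := by exact_mod_cast hs0
  have hϖQ0 : (ϖ : ℚ_[2]) ≠ 0 := by exact_mod_cast hϖ0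
  have h20 : (2 : ℚ_[2]) ≠ 0 := two_ne_zero
  have hc₁0 : c₁ ≠ 0 := by
    intro h0
    rw [h0, zero_mul] at hGS1
    exact (mul_ne_zero hLI hsQ0) hGS1.symm
  have hvc₁ : c₁.valuation = (LInvariant Dq).valuation + padicValRat 2 s - 2 := by
    have h := congrArg Padic.valuation hGS1
    rw [Padic.valuation_mul hc₁0 hlg0, Padic.valuation_mul hLI hsQ0, hvlg,
      Padic.valuation_ratCast] at h
    linarith
  -- `L₁(0) = ϖ · c₁ ≠ 0`
  have hg0 : ((PowerSeries.constantCoeff L₁ : ℤ_[2]) : ℚ_[2]) = (ϖ : ℚ_[2]) * c₁ := by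
    have h1 := congrArg (PowerSeries.coeff 1) hιL₁
    rw [coeff_one_iwasawaToPowerSeries_X_mul, PowerSeries.coeff_C_mul] at h1
    exact h1
  have hg00 : PowerSeries.constantCoeff L₁ ≠ 0 := by
    intro h0
    rw [h0, PadicInt.coe_zero] at hg0
    exact (mul_ne_zero hϖQ0 hc₁0) hg0.symm
  have hSelfin : Finite (W.selmerGroupPInfty 2) :=
    D.finite_selmerGroupPInfty_of_constantCoeff_ne_zero W hγ hX L₁ hchar hg00
  obtain ⟨hEfin, hShapfin⟩ := (W.finite_selmerGroupPInfty_iff 2).mp hSelfin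
  haveI := hEfin
  haveI := hShapfin
  haveI := hSelfin
  have hr : W.analyticRank = 0 := analyticRank_eq_zero_of_entireLFunction_one_ne_zero W hL
  obtain ⟨-, hfin⟩ := hGZK W (by rw [hr]; exact zero_le_one)
  haveI : Finite W.sha := hfin
  -- Greenberg's split display with `f_E := L₁`
  obtain ⟨u₁, hu₁⟩ := hEC hmult hsp κ γ hκ hγ hγ' D hX L₁ hchar hSelfin Dq hlog
  rw [add_zero, zpow_natCast] at hu₁
  haveI : NeZero (2 : ℕ) := ⟨two_ne_zero⟩
  obtain ⟨u₄, hu₄⟩ := exists_unit_torsionOrder_eq W 2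
  obtain ⟨u₅, hu₅⟩ := exists_unit_natCard_eq_mul_card_primaryComponent W.sha 2
  have hSel : Nat.card (W.selmerGroupPInfty 2) = Nat.card (AddCommGroup.primaryComponent W.sha 2) :=
    W.natCard_selmerGroupPInfty_eq_natCard_primaryComponent_sha 2
  set v := padicValNat 2 W.tamagawaProduct with hv
  set Tp : ℚ_[2] := (Nat.card (AddCommGroup.primaryComponent W.toAffine.Point 2) : ℚ_[2]) with hTp
  set Shp : ℚ_[2] := (Nat.card (AddCommGroup.primaryComponent W.sha 2) : ℚ_[2]) with hShp
  set ℓ4 : ℚ_[2] := LInvariant Dq / 4 with hℓ4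
  have h40 : (4 : ℚ_[2]) ≠ 0 := by norm_num
  have hℓ40 : ℓ4 ≠ 0 := by rw [hℓ4]; exact div_ne_zero hLI h40
  have hv2 : (2 : ℚ_[2]).valuation = 1 := by
    have h2 : ((2 : ℕ) : ℚ_[2]).valuation = 1 := Padic.valuation_p
    rwa [Nat.cast_ofNat] at h2
  have hv4 : (4 : ℚ_[2]).valuation = 2 := by
    rw [show (4 : ℚ_[2]) = 2 * 2 by norm_num, Padic.valuation_mul h20 h20, hv2]
    norm_num
  have hvℓ4 : ℓ4.valuation = (LInvariant Dq).valuation - 2 := by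
    rw [hℓ4, div_eq_mul_inv, Padic.valuation_mul hLI (inv_ne_zero h40), Padic.valuation_inv, hv4]
    ring
  have hu₄' : (W.torsionOrder : ℚ_[2]) = ((u₄ : ℤ_[2]) : ℚ_[2]) * Tp := by
    rw [hu₄, hTp]
    congr 1
    exact_mod_cast natCard_primaryComponent_point_congr W 2 _ _
  have hSha : (W.shaOrder : ℚ_[2]) = ((u₅ : ℤ_[2]) : ℚ_[2]) * Shp := by
    rw [WeierstrassCurve.shaOrder, hShp]
    exact hu₅
  have hSel' : (Nat.card (W.selmerGroupPInfty 2) : ℚ_[2]) = Shp := by rw [hShp, hSel]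
  -- the identity `ϖ · c₁ · Tp² = u₁ · (𝓛/4) · 2^v · Shp` in `ℚ_2`
  have key : (ϖ : ℚ_[2]) * c₁ * Tp ^ 2 =
      ((u₁ : ℤ_[2]) : ℚ_[2]) * ℓ4 * (2 : ℚ_[2]) ^ v * Shp := by
    rw [← hg0, hu₁, hSel']
  have hTp0 : Tp ≠ 0 := by rw [hTp]; exact_mod_cast Nat.card_pos.ne'
  have hShp0 : Shp ≠ 0 := by rw [hShp]; exact_mod_cast Nat.card_pos.ne'
  have hvalL : ((ϖ : ℚ_[2]) * c₁ * Tp ^ 2).valuation =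
      padicValRat 2 ϖ + c₁.valuation + 2 * Tp.valuation := by
    rw [Padic.valuation_mul (mul_ne_zero hϖQ0 hc₁0) (pow_ne_zero 2 hTp0),
      Padic.valuation_mul hϖQ0 hc₁0, Padic.valuation_pow Tp, Padic.valuation_ratCast]
    push_cast
    ring
  have hvalR : (((u₁ : ℤ_[2]) : ℚ_[2]) * ℓ4 * (2 : ℚ_[2]) ^ v * Shp).valuation =
      ℓ4.valuation + (v : ℤ) + Shp.valuation := by
    have hu₁0 : ((u₁ : ℤ_[2]) : ℚ_[2]) ≠ 0 := coe_units_ne_zero 2 u₁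
    rw [Padic.valuation_mul (mul_ne_zero (mul_ne_zero hu₁0 hℓ40) (pow_ne_zero _ h20)) hShp0,
      Padic.valuation_mul (mul_ne_zero hu₁0 hℓ40) (pow_ne_zero _ h20),
      Padic.valuation_mul hu₁0 hℓ40, valuation_coe_units_eq_zero, Padic.valuation_pow, hv2]
    ring
  have hval := congrArg Padic.valuation key
  rw [hvalL, hvalR] at hval
  have hvT : Tp.valuation = (padicValNat 2 W.torsionOrder : ℤ) := by
    have h' := congrArg Padic.valuation hu₄'
    rw [Padic.valuation_natCast, Padic.valuation_mul (coe_units_ne_zero 2 u₄) hTp0,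
      valuation_coe_units_eq_zero, zero_add] at h'
    exact h'.symm
  have hvS : Shp.valuation = (padicValNat 2 W.shaOrder : ℤ) := by
    have h' := congrArg Padic.valuation hSha
    rw [Padic.valuation_natCast, Padic.valuation_mul (coe_units_ne_zero 2 u₅) hShp0,
      valuation_coe_units_eq_zero, zero_add] at h'
    exact h'.symm
  rw [hvT, hvS, hvℓ4, hvc₁] at hval
  -- Miller's currency: `#Ш_an = t · #E(ℚ)² / ∏ c_ℓ`
  have hvt : padicValRat 2 t = padicValRat 2 ϖ + padicValRat 2 s := by
    rw [ht_def, padicValRat.mul hϖ0 hs0]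
  obtain ⟨-, hE, -, hshaAn⟩ := shaAn_eq_of_L_one_div_eq hGZK W hL hq
  haveI := hE
  have ht0 : t ≠ 0 := by rw [ht_def]; exact mul_ne_zero hϖ0 hs0
  have hcard : (Nat.card W.toAffine.Point : ℚ) ≠ 0 := by
    exact_mod_cast (Nat.card_pos (α := W.toAffine.Point)).ne'
  have htam : (W.tamagawaProduct : ℚ) ≠ 0 := by
    exact_mod_cast (W.tamagawaProduct_pos_holds : 0 < W.tamagawaProduct).ne'
  have hcardT : (Nat.card W.toAffine.Point : ℚ) = (W.torsionOrder : ℚ) := by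
    exact_mod_cast (W.torsionOrder_eq_natCard_of_finite).symm
  refine ⟨t * (Nat.card W.toAffine.Point : ℚ) ^ 2 / (W.tamagawaProduct : ℚ), hshaAn, ?_⟩
  rw [padicValRat.div (mul_ne_zero ht0 (pow_ne_zero 2 hcard)) htam,
    padicValRat.mul ht0 (pow_ne_zero 2 hcard), padicValRat.pow, hcardT]
  simp only [padicValRat.of_nat, Nat.cast_ofNat]
  linarith

omit [W.IsGloballyMinimal] in
/-- **The rank-`0` `2`-CONVERSE from the split main-conjecture equality (PROVED).** Same data with
`char_Λ X = (L₁)`, `ι(T·L₁) = ϖ·L`; if `Sel_{2^∞}(E/ℚ)` is finite then `L(E,1) ≠ 0` (and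
`r_an(E) = 0`): A236 gives `L₁(0) ≠ 0`, i.e. `[T¹]L ≠ 0`, and Greenberg–Stevens at `2` turns
`[T¹]L·log₂ γ = 𝓛₂(E)·[0]⁺_f` into `[0]⁺_f ≠ 0`. No `BSD₂`, no lower divisibility, no `hκ₁`.
[cite: GreenbergLNM1716, §4 pp. 112–113] [cite: MazurTateTeitelbaum1986Invent, §II] -/
theorem entireLFunction_one_ne_zero_of_finite_selmer_of_charIdeal_eq_span_split
    (hEC : TwoAdicEulerCharRankZeroSplitMult W 0)
    (hGS : greenberg_stevens (W := W) (p := 2))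
    (hmult : Mult W 2) (hsp : W.HasSplitMultiplicativeReductionAtPrime 2)
    {κ : ZpExtension ℚ 2} {γ : Field.absoluteGaloisGroup ℚ} {N : ℕ} [NeZero N]
    {f : CuspForm (Gamma0 N) 2} (hκ : κ.IsCyclotomic) (hγ : κ.IsTopGenerator γ)
    (hγ' : IsCyclotomicVariable 2 γ) (hf : IsNewformOf W f) {L : PowerSeries ℚ_[2]}
    (hLf : IsSplitMultPAdicLFunctionOf f 2 L) (D : W.SelmerDualData κ γ) (hX : D.IsTorsion)
    {ϖ : ℚ} {L₁ : IwasawaAlgebra 2}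
    (hιL₁ : iwasawaToPowerSeries 2 (PowerSeries.X * L₁) = PowerSeries.C (ϖ : ℚ_[2]) * L)
    (hchar : D.charIdeal = Ideal.span {L₁}) (hfin : Finite (W.selmerGroupPInfty 2)) :
    W.entireLFunction 1 ≠ 0 ∧ W.analyticRank = 0 := by
  haveI : Module.Finite (IwasawaAlgebra 2) D.X := D.module_finite_holds hγ
  haveI := hfin
  obtain ⟨hEfin, hShapfin⟩ := (W.finite_selmerGroupPInfty_iff 2).mp hfin
  haveI := hEfin
  haveI := hShapfin
  obtain ⟨Dq⟩ := (nonempty_tateParameterData_iff_holds (W := W) (p := 2)).mpr hsp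
  have hlog : padicLog 2 Dq.q ≠ 0 := Dq.padicLog_q_ne_zero MahlerManinPadic_holds
  obtain ⟨u₁, hu₁⟩ := hEC hmult hsp κ γ hκ hγ hγ' D hX L₁ hchar hfin Dq hlog
  have hR : ((u₁ : ℤ_[2]) : ℚ_[2]) * (LInvariant Dq / 4) *
      (2 : ℚ_[2]) ^ ((padicValNat 2 W.tamagawaProduct : ℤ) + 0) *
      (Nat.card (W.selmerGroupPInfty 2) : ℚ_[2]) ≠ 0 := by
    refine mul_ne_zero (mul_ne_zero (mul_ne_zero (coe_units_ne_zero 2 u₁)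
      (div_ne_zero (LInvariant_ne_zero_holds (W := W) (p := 2) Dq) (by norm_num)))
      (zpow_ne_zero _ two_ne_zero)) ?_
    exact_mod_cast Nat.card_pos.ne'
  rw [← hu₁] at hR
  have hL₁0 : ((PowerSeries.constantCoeff L₁ : ℤ_[2]) : ℚ_[2]) ≠ 0 :=
    fun h0 => hR (by rw [h0, zero_mul])
  have hc : ((PowerSeries.constantCoeff L₁ : ℤ_[2]) : ℚ_[2]) = (ϖ : ℚ_[2]) * PowerSeries.coeff 1 L := by
    have h1 := congrArg (PowerSeries.coeff 1) hιL₁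
    rw [coeff_one_iwasawaToPowerSeries_X_mul, PowerSeries.coeff_C_mul] at h1
    exact h1
  have hc₁0 : PowerSeries.coeff 1 L ≠ 0 := by
    intro h0
    apply hL₁0
    rw [hc, h0, mul_zero]
  obtain ⟨-, hGS1⟩ := hGS Dq hf hLf
  have hs0 : ratPlusSymbol f 0 ≠ 0 := by
    intro h0
    rw [h0, Rat.cast_zero, mul_zero] at hGS1
    rcases mul_eq_zero.mp hGS1 with h | h
    · exact hc₁0 h
    · have hv := valuation_padicLog_cyclotomicGenerator_two_eq
      rw [h, Padic.valuation_zero] at hv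
      exact absurd hv (by norm_num)
  have hL : W.entireLFunction 1 ≠ 0 := by
    rw [hf.entireLFunction_one_eq]
    have hper : 0 < plusPeriod f := IsNewform0.plusPeriod_pos_holds hf.1 hf.coeffField_eq_bot
    exact_mod_cast mul_ne_zero (Rat.cast_ne_zero.mpr hs0) hper.ne'
  exact ⟨hL, analyticRank_eq_zero_of_entireLFunction_one_ne_zero W hL⟩

end Summit.BirchSwinnertonDyer.Rank1Residual.X5.O1

end
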